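import Summits.Ventures.AbcShadow.SH01.BVY04Package
import Summits.Ventures.AbcShadow.SH04.BD10Package
import Summits.Ventures.AbcSig.Sieve.CertificateModN

/-!
# Venture AbcShadow — SH-04, the L\* route: a DISTINGUISHED-PRIME sieve certificate and the congruence-transfer hypothesis

HONEST FRAMING. Interface + certificate-checker file of the work-bound cell `abc-shadow` (typer seat `abc-shadow-typ-1`,
lineage g3). NOTHING here is a theorem about a Diophantine equation; nothing here is a claim on abc or on any summit; no side
on IUT. Context: seven of the ten printed possibly-exceptional pairs `(p, n)` of [BVY04, Thm 1.6] — `(13,19), (43,13), (61,61),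
(67,73), (79,97), (97,13), (97,79)` — (and both pairs of [Thm 1.7]) are CLOSED-by-us in the cell's census by the route the cell
calls L\* (critic memo `pub/abc-shadow/crit-1-SH30.md`, sha16 f156d45a09d77339; certificate 4a36c28685fe0350 part C + extension
j314368 part E2; crit-1's independent job j314495 at the `n`-maximal order): at the levels `3^δ·p` EVERY newform orbit is excluded
by the [Prop 4.2] sieve at the exponent `n` EXCEPT exactly one (orbit, prime) pair `(g, 𝔓)`, `𝔓 = (n, θ)` a ramified degree-one
prime of the Hecke order `ℤ[θ]`, and that pair is a GENUINE congruence: `g ≡ f^{(p)} (mod 𝔓)` coefficientwise up to the Sturm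
bound, `f` = the CM newform 27a1 (level 27, `y² + y = x³ − 7`, `j = 0`, CM by `ℚ(√−3)`), `f^{(p)}` its `p`-stabilisation. Hence
"`ρ^E_n` arises from `g`" forces "`ρ^E_n` arises from `f`", a newform WITH CM by `ℚ(√−3)`, which [BVY04, Prop 4.3] — whose printed
statement and proof are level-free ("Suppose that `ρ^E_n` arises from a newform having CM by an order in an imaginary quadratic
field `K`", p. 1407; model proof [BS04, Prop 4.6] read line by line by the cell's LIT-1 seat) — excludes: (a) needs `2` split in
`K` (inert in `ℚ(√−3)`), (b) needs `n ∈ {5, 7, 13}` (and then the printed rank inputs of p. 1407 and `3 ∣ ab`). THIS FILE supplies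
the two Lean pieces the typed rows of these pairs need:

* KERNEL (proved here): `splitCheckModN` + `matchesModAt_of_split` — a DISTINGUISHED-PRIME certificate. Given orbit data `o`
  (field polynomial `F`), an integer `r`, an exponent `e`, a cofactor `F₂` with `F ≡ (X − r)^e · F₂ (mod n)` coefficientwise
  (`decide`) and a mod-`n` sieve tree (`Summit.Ventures.AbcSig.TreeN`) that passes when run from the generators `[F, F₂]` (i.e. on
  the primes above `n` containing `F₂(θ)` = all primes above `n` of `ℤ[θ]` other than `𝔓 = (n, θ − r)`), every newform `f` matching
  `o` whose [Prop 4.2] congruences hold modulo some prime above `n` (`ArisesMod`) satisfies `MatchesModAt M f o n A r`: the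
  congruences hold for a ring map `ψ : Coeff f → k`, `char k = n`, with `ψ(θ) = r` — i.e. they hold MODULO `𝔓`. (Proof: in the
  field `k`, `0 = ψ(F(θ)) = (ψθ − r)^e · ψ(F₂(θ))`, and the tree forbids `ψ(F₂(θ)) = 0`.) So the KERNEL, not the engine, establishes
  that `𝔓` is the only prime of the orbit that can carry `ρ^E_n`.
* NAMED HYPOTHESIS (COMPUTED + CITED, never proved here): `CMNewformModel.LStarTransfer N o n r N' D` — "for a datum of exponent
  `n` coming from a primitive solution with `ab ≠ ±1`: if `ρ^E_n` arises from a newform `f` of level `N` matching `o` AND the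
  [Prop 4.2] congruences of `f` hold modulo a prime through which `θ ≡ r`, then `ρ^E_n` arises from some newform `g` of level `N'`
  having CM by `ℚ(√D)`". Content in the intended model: COMPUTED = the `q`-expansion congruence `o ≡ 27a1^{(p)} (mod 𝔓)` at all
  indices up to the Sturm bound of `Γ₀(N)` (+20), including the `p`-stabilisation condition `c_p(g)² − a_p(f)·c_p(g) + p ≡ 0`
  (certificate extension j314368 part E2 "MATCH … f = newform 27.1"; crit-1 j314495, `n`-maximal order, `q = n` included — two
  implementations of everything except the modular-symbols library); CITED = Sturm's theorem (J. Sturm, LNM 1240 (1987): congruence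
  up to the bound ⇒ congruence of all coefficients), `tr ρ_{g,𝔓}(Frob_q) = c_q(g) (mod 𝔓)` with Chebotarev + Brauer–Nesbitt (equal
  traces at all `q ∤ nN` ⇒ isomorphic semisimplifications), [BVY04, Lemma 3.1] (`ρ^E_n` irreducible for `n ≥ 5`, `ab ≠ ±1` —
  whence the restriction of the hypothesis to such data) and the definition of "arises from" [BVY04, p. 1405]. The cell labels
  this route «OUR LEMMA-LEVEL INPUT (L\*)», signed by its critic and read by LIT-1 inside [BS04, Prop 4.6]'s printed argument; it is
  NOT a theorem printed in [BVY04] for these pairs, and every row using it says so in its docstring and ledger table.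
* KERNEL bookkeeping for the SANITY SLICE of that congruence checked in the level files: `cm27Trace q` = the trace of Frobenius
  `a_q` of 27a1 COMPUTED IN THE KERNEL as `−Σ_{x mod q} χ_q(4x³ − 27)` (`y² + y = x³ − 7 ⇔ (2y+1)² = 4x³ − 27`; Legendre symbol
  `legendreSymZ` of `SH04/BD10Package.lean`), evaluated at `q ≤ 43` (`cm27Trace_values`); `evalAtL r g = g(r)`. The level files
  check `g_q(r) ≡ d_q · a_q(27a1) (mod n)` at their listed primes `q ≤ 37` — a kernel re-check of the first terms of the COMPUTED
  congruence, NOT a substitute for the Sturm-bound certificate.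

References: [BVY04] Bennett–Vatsal–Yazdani, Compositio Math. 140 (2004) 1399–1416 (Lemma 3.1 p.1404, def. p.1405, Prop 4.2/4.3
pp.1406–1407); [BS04] Bennett–Skinner, Canad. J. Math. 56 (2004), Prop 4.6; J. Sturm, LNM 1240 (1987) 275–280; Cremona's tables
(27a1 = `[0,0,1,0,−7]`). AI-typed; weaker than expert refereeing.
-/

namespace Summit.Ventures.AbcShadow

open Polynomial
open Summit.Ventures.AbcSig (NewformModel FreyDatum OrbitData CoeffEntry TreeN toPoly mulL addL smulL isZeroModL evalL
  map_toPoly_eq_zero_of_isZeroModL toPoly_addL toPoly_mulL toPoly_smulL toPoly_cons toPoly_nil)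

/-! ## Kernel: the distinguished-prime certificate -/

/-- Coefficient list of `(X − r)^e` (little-endian). [folklore] -/
def linPowL (r : ℤ) : ℕ → List ℤ
  | 0 => [1]
  | e + 1 => mulL [-r, 1] (linPowL r e)

/-- `toPoly (linPowL r e) = (X − C r)^e`. [folklore] -/
theorem toPoly_linPowL (r : ℤ) : ∀ e : ℕ, toPoly (linPowL r e) = (X - C r) ^ e
  | 0 => by simp [linPowL]
  | e + 1 => by
      have h1 : toPoly [-r, 1] = X - C r := by
        simp only [toPoly_cons, toPoly_nil, C_neg, map_one]
        ring
      rw [linPowL, toPoly_mulL, toPoly_linPowL r e, h1, pow_succ]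
      ring

/-- **Split check** (computable, evaluated by `decide`): `F ≡ (X − r)^e · F₂ (mod n)` coefficientwise. [folklore] -/
def splitCheckModN (n : ℕ) (F : List ℤ) (r : ℤ) (e : ℕ) (F₂ : List ℤ) : Bool :=
  isZeroModL n (addL F (smulL (-1) (mulL (linPowL r e) F₂)))

/-- If `F ≡ (X − r)^e · F₂ (mod n)` then every ring homomorphism `φ : ℤ[X] → k` into a field of characteristic `n` with
`φ(F) = 0` has `φ(X) = r` or `φ(F₂) = 0` (a field has no zero divisors). [folklore] -/
theorem split_sound {n : ℕ} {F F₂ : List ℤ} {r : ℤ} {e : ℕ} (h : splitCheckModN n F r e F₂ = true)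
    {k : Type} [Field k] [CharP k n] (φ : ℤ[X] →+* k) (hF : φ (toPoly F) = 0) :
    φ X = (r : k) ∨ φ (toPoly F₂) = 0 := by
  have hC : ∀ a : ℤ, φ (C a) = (a : k) := fun a => by
    rw [show (C a : ℤ[X]) = (a : ℤ[X]) from Polynomial.C_eq_intCast a, map_intCast]
  have h0 := map_toPoly_eq_zero_of_isZeroModL n φ _ h
  rw [toPoly_addL, toPoly_smulL, toPoly_mulL, toPoly_linPowL] at h0
  simp only [map_add, map_mul, map_pow, map_sub, hF, hC, zero_add, Int.cast_neg, Int.cast_one, neg_mul, one_mul,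
    neg_eq_zero] at h0
  rcases mul_eq_zero.mp h0 with h2 | h2
  · by_cases he : e = 0
    · subst he
      simp at h2
    · exact Or.inl (sub_eq_zero.mp ((pow_eq_zero_iff he).mp h2))
  · exact Or.inr h2

/-- `MatchesModAt M f o n A r`: the newform `f` carries the orbit data `o` through some `θ ∈ Coeff f` (`F(θ) = 0`,
`d_ℓ·c_ℓ(f) = g_ℓ(θ)`) AND there is a ring homomorphism `ψ : Coeff f → k` into a field of characteristic `n` with `ψ(θ) = r` and
`ψ(c_ℓ(f)) ∈ A(ℓ)` for every odd prime `ℓ ≠ n`, `ℓ ∤ N` — the conjunction of `M.Matches f o` and `M.ArisesMod f n A` with the SAME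
`θ` and the extra datum "`ψ` factors through the prime `𝔓 = (n, θ − r)`". Intended reading: the [BVY04, Prop 4.2] congruences of
`f` hold modulo `𝔓`. [cite: BennettVatsalYazdani2004, Prop 4.2 p.1406 (the congruences, at one named prime above n)] -/
def MatchesModAt (M : NewformModel) {N : ℕ} (f : M.Form N) (o : OrbitData) (n : ℕ) (A : ℕ → List ℤ) (r : ℤ) : Prop :=
  ∃ θ : M.Coeff N f, evalL θ o.F = 0 ∧ (∀ c ∈ o.coeffs, (c.d : M.Coeff N f) * M.eig N f c.ell = evalL θ c.g) ∧
    ∃ (k : Type) (_ : Field k) (_ : CharP k n) (ψ : M.Coeff N f →+* k), ψ θ = (r : k) ∧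
      ∀ ℓ : ℕ, ℓ.Prime → ℓ ≠ 2 → ℓ ≠ n → ¬ ℓ ∣ N → ∃ t ∈ A ℓ, ψ (M.eig N f ℓ) = (t : k)

/-- **Soundness of the distinguished-prime certificate.** If `F ≡ (X − r)^e·F₂ (mod n)` (`splitCheckModN`) and the mod-`n` sieve tree
`T` passes when run from the generators `[F, F₂]` (so NO prime above `n` containing `F₂(θ)` carries the allowed traces), then every
newform matching `o` (entries at odd primes not dividing the level) with `ArisesMod f n A` satisfies `MatchesModAt M f o n A r`:
its congruences hold modulo a prime through which `θ ≡ r`. Proof: `ψ ∘ (x ↦ θ) : ℤ[X] → k` kills `F`, hence `ψ(θ) = r` or it kills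
`F₂`; the latter realises the allowed traces from `[F, F₂]`, which `TreeN.check_sound` forbids.
[cite: BennettVatsalYazdani2004, Prop 4.2 p.1406 (kernel certificate: the congruences single out one prime above n)] -/
theorem matchesModAt_of_split (M : NewformModel) {N : ℕ} (f : M.Form N) (o : OrbitData) (hfo : M.Matches f o)
    (n : ℕ) (A : ℕ → List ℤ) (r : ℤ) (e : ℕ) (F₂ : List ℤ) (T : TreeN) (fuel : ℕ)
    (hsplit : splitCheckModN n o.F r e F₂ = true) (hT : T.check n fuel o A [o.F, F₂] = true)
    (hgood : ∀ c ∈ o.coeffs, c.ell.Prime ∧ c.ell ≠ 2 ∧ ¬ c.ell ∣ N) (hmod : M.ArisesMod f n A) :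
    MatchesModAt M f o n A r := by
  obtain ⟨θ, hF, hc⟩ := hfo
  obtain ⟨k, hk, hchar, ψ, hψ⟩ := hmod
  refine ⟨θ, hF, hc, k, hk, hchar, ψ, ?_, hψ⟩
  let φ : ℤ[X] →+* k := ψ.comp (Polynomial.eval₂RingHom (Int.castRingHom (M.Coeff N f)) θ)
  have hφ : ∀ P : List ℤ, φ (toPoly P) = ψ (evalL θ P) := fun P => rfl
  have hφF : φ (toPoly o.F) = 0 := by rw [hφ, hF, map_zero]
  have hφX : φ X = ψ θ := by
    show ψ (Polynomial.eval₂RingHom (Int.castRingHom (M.Coeff N f)) θ X) = ψ θ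
    rw [Polynomial.coe_eval₂RingHom, Polynomial.eval₂_X]
  rcases split_sound hsplit φ hφF with h | h
  · rw [← hφX]
    exact h
  · exfalso
    refine Summit.Ventures.AbcSig.TreeN.check_sound n fuel T o A [o.F, F₂] hT k φ ?_ ?_
    · intro P hP
      simp only [List.mem_cons, List.not_mem_nil, or_false] at hP
      rcases hP with rfl | rfl
      · exact hφF
      · exact h
    · intro c hc' hne
      obtain ⟨hp, h2, hN⟩ := hgood c hc'
      obtain ⟨t, ht, hψt⟩ := hψ c.ell hp h2 hne hN
      refine ⟨t, ht, ?_⟩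
      rw [hφ, ← hc c hc', map_mul, hψt, map_intCast]

/-! ## The named hypothesis of the L\* route -/

/-- **NAMED HYPOTHESIS (COMPUTED + CITED) — the L\* congruence transfer** `M.LStarTransfer N o n r N' D`: for every datum
`S = (A, B, C, n, a, b, c)` of exponent `n` which is a primitive solution (`Aa, Bb, Cc` pairwise coprime and nonzero,
`A aⁿ + B bⁿ = C c³`) with `ab ≠ ±1` (so that `ρ^E_n` is irreducible, [BVY04, Lemma 3.1], and "arises from" [p. 1405] is
unambiguous): IF `ρ^E_n` arises from a newform `f` of level `N` matching the orbit data `o` and the [Prop 4.2] congruences of `f`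
hold modulo a prime of its coefficient ring through which `θ ≡ r` (`MatchesModAt`), THEN `ρ^E_n` arises from some newform `g` of
level `N'` having CM by an order of `ℚ(√D)`. NATURE (module docstring): COMPUTED — the coefficientwise congruence
`o ≡ 27a1^{(p)} (mod (n, θ − r))` up to the Sturm bound (certificate 4a36c28685fe0350 extension j314368 part E2; crit-1 j314495) —
plus CITED — Sturm's theorem, traces of Frobenius / Chebotarev / Brauer–Nesbitt, [BVY04, Lemma 3.1 and p. 1405]; the cell's
«lemma-level input L\*» (crit-1-SH30.md f156d45a09d77339), NOT a statement printed in [BVY04] for these pairs. Rows instantiate it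
with `N = 27p`, `N' = 27`, `D = −3`, `r = 0` (resp. `N = 243p`, `N' = 243` for Thm 1.7). Never proved here.
[cite: BennettVatsalYazdani2004, Lemma 3.1 p.1404; p.1405 (arises from); Prop 4.3 p.1407 (the CM hypothesis it feeds)] -/
def CMNewformModel.LStarTransfer (M : CMNewformModel) (N : ℕ) (o : OrbitData) (n : ℕ) (r : ℤ) (N' : ℕ) (D : ℤ) : Prop :=
  ∀ S : FreyDatum, S.n = n → IsPrimitiveSolution S.A S.B S.C S.n S.a S.b S.c → S.a * S.b ≠ 1 → S.a * S.b ≠ -1 →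
    ∀ f : M.Form N, M.Arises S N f → MatchesModAt M.toNewformModel f o n bvy04AllowedPrint r →
      ∃ g : M.Form N', M.HasCM N' g D ∧ M.Arises S N' g

/-! ## Kernel bookkeeping for the sanity slice of the congruence: traces of 27a1, evaluation at `r` -/

/-- The trace of Frobenius `a_q` of the CM elliptic curve 27a1: `y² + y = x³ − 7` (Cremona `[0,0,1,0,−7]`, `j = 0`, CM by
`ℚ(√−3)`), for an odd prime `q ≠ 3`, COMPUTED IN THE KERNEL by point counting: `y² + y = x³ − 7 ⇔ (2y + 1)² = 4x³ − 27`, so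
`#E(𝔽_q) = q + 1 + Σ_x χ_q(4x³ − 27)` and `a_q = −Σ_{x mod q} χ_q(4x³ − 27)`. (At `q ≡ 2 (mod 3)`, inert in `ℚ(√−3)`, `a_q = 0`.)
[folklore] -/
def cm27Trace (q : ℕ) : ℤ :=
  -(((List.range q).map fun x : ℕ => legendreSymZ (4 * (x : ℤ) ^ 3 - 27) q).sum)

/-- The traces of 27a1 at the odd primes `5 ≤ q ≤ 43`, `q ≠ 3` (kernel evaluation): `0, −1, 0, 5, 0, −7, 0, 0, −4, 11, 0, 8` at
`q = 5, 7, 11, 13, 17, 19, 23, 29, 31, 37, 41, 43` (Cremona's table for 27a1 agrees; `a_q = 0` exactly at `q ≡ 2 (mod 3)`). [folklore] -/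
theorem cm27Trace_values :
    ([5, 7, 11, 13, 17, 19, 23, 29, 31, 37, 41, 43] : List ℕ).map cm27Trace = [0, -1, 0, 5, 0, -7, 0, 0, -4, 11, 0, 8] := by
  decide +kernel

/-- `evalAtL r g = g(r)` for a little-endian coefficient list `g` (Horner; computable, for the kernel checks of the level files). [folklore] -/
def evalAtL (r : ℤ) : List ℤ → ℤ
  | [] => 0
  | a :: g => a + r * evalAtL r g

/-- `evalAtL` agrees with polynomial evaluation: `evalAtL r g = (toPoly g).eval r`. [folklore] -/
theorem evalAtL_eq_eval (r : ℤ) : ∀ g : List ℤ, evalAtL r g = (toPoly g).eval r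
  | [] => by simp [evalAtL]
  | a :: g => by simp [evalAtL, evalAtL_eq_eval r g, Polynomial.eval_add, Polynomial.eval_mul]

end Summit.Ventures.AbcShadow
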